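/-
Copyright (c) 2026. All rights reserved.
Released under Apache 2.0 license as described in the file LICENSE.
Authors: abc-iut cell — seat abc-iut-w5-d226 (wave 5), over abc-iut-L4-t12's
`HolomorphicEllipticCuspidalization.lean` and the `ComplexTorus` library.
-/
import Literature.AnabelianGeometry.AbsoluteAnabelian.HolomorphicEllipticCuspidalizationFiniteEtale
import Mathlib.Analysis.Normed.Module.Connected
import HarnessLib

/-!
# [AbsTopIII] Cor 2.7 (b), sub-nodes (b).3 / (b).3♯: the deck transformations of `[N] : 𝕌_N → 𝔼` — PROOF

Sub-DAG `plan/L4/SUBDAG-AbsTopIII-Cor-27.md`, row Cor-27.b.r6: the named statements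
`HolomorphicEllipticCuspidalization.NsmulDeckAbelianTransitive` ((b).3: "`𝕌 → 𝔼` is an ABELIAN finite
étale covering" — the deck group `Gal(𝕌_N/𝔼)` is commutative and transitive on fibres) and
`HolomorphicEllipticCuspidalization.NsmulDeckGroup` ((b).3♯: "the group structure on these torsion points
[which is induced by the group structure of the Galois group `Gal(𝕌/𝔼)`]" — `Gal(𝕌_N/𝔼) ≅ T[N]`, every
deck transformation being the restriction of the translation by a unique `N`-torsion point) of
abc-iut-L4-t12's statements file (p414370), [AbsTopIII] Cor 2.7 (b) p.59 l.7, l.13–14 (quoting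
[AbsTopII] Ex 3.2 (i)).  Bib key `MochizukiAbsTopIII2015`.

Proof-only (kind=proof; no new notions, no `def`).  Steps: (1) `𝕌_N = T ∖ T[N]` is PATH-CONNECTED — its
preimage in the universal cover `ℝ^ι ≅ ℂ` is the complement of the countable set `π⁻¹(T[N])` in a
real vector space of dimension `2 > 1` (Mathlib `Set.Countable.isPathConnected_compl_of_one_lt_rank`),
and `𝕌_N` is its image; (2) translations by `N`-torsion points restrict to deck transformations of
`[N]∣𝕌_N`; (3) a deck transformation of a covering with connected total space is determined by one
value (`ComplexTorus.deck_eq_of_apply_eq`, over (b).1 = `isFiniteEtale_nsmulCov`), so every deck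
transformation is such a translation; (4) the assembled statements.  Refereed classical material;
nothing here bears on the disputed [IUTchIII] Cor. 3.12.
-/

noncomputable section

namespace Literature.AnabelianGeometry.AbsoluteAnabelian

namespace HolomorphicEllipticCuspidalization

open _root_.TopologicalSpace _root_.Topology
open Literature.Geometry.Kaehler (ComplexTorus)
open Literature.Geometry.Kaehler.ComplexTorus

section

variable {ι : Type} [Fintype ι] (Φ : (ι → ℝ) ≃L[ℝ] ℂ)

/-! ### (1) `𝕌_N` is path-connected -/

omit [Fintype ι] in
/-- The index type of a one-dimensional complex torus `ℂ/Ψ(ℤ^ι)` is non-empty (`ℝ^ι ≅ ℂ`).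
[cite: MochizukiAbsTopIII2015, Corollary 2.7 (a) p.58] -/
theorem nonempty_index (Ψ : (ι → ℝ) ≃L[ℝ] ℂ) : Nonempty ι := by
  by_contra h
  rw [not_nonempty_iff] at h
  have h01 : (Ψ.symm 0 : ι → ℝ) = Ψ.symm 1 := Subsingleton.elim _ _
  exact zero_ne_one (Ψ.symm.injective h01)

/-- The complement of a FINITE subset of the torus `T = ℂ/Λ` is path-connected: it is the image under
the covering map `π : ℝ^ι → T` of the complement of the countable set `π⁻¹(F)` in the plane
`ℝ^ι ≅ ℂ` (real dimension `2 > 1`). [folklore] [cite: MochizukiAbsTopIII2015, Corollary 2.7 (b) p.59] -/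
theorem isPathConnected_compl_of_finite {F : Set (ComplexTorus Φ)} (hF : F.Finite) :
    IsPathConnected Fᶜ := by
  have hsurj : Function.Surjective (proj Φ) := fun t => ⟨lift Φ t, proj_lift Φ t⟩
  -- the preimage of `F` is countable: each fibre is a translate of the lattice `ℤ^ι`
  have hcount : (proj Φ ⁻¹' F).Countable := by
    have hF' : proj Φ ⁻¹' F = ⋃ t ∈ F, proj Φ ⁻¹' {t} := by
      rw [← Set.preimage_iUnion₂, Set.biUnion_of_singleton]
    rw [hF']
    refine hF.countable.biUnion fun t _ => ?_
    refine (Set.countable_range (fun n : ι → ℤ => lift Φ t + intVec n)).mono ?_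
    intro x hx
    have hx' : proj Φ (lift Φ t) = proj Φ x := by rw [proj_lift]; exact hx.symm
    obtain ⟨n, hn⟩ := (proj_eq_proj_iff_exists_intVec Φ).1 hx'
    exact ⟨n, hn.symm⟩
  have hrank : 1 < Module.rank ℝ (ι → ℝ) := by
    rw [← Module.finrank_eq_rank, LinearEquiv.finrank_eq Φ.toLinearEquiv, Complex.finrank_real_complex]
    norm_num
  have hpc : IsPathConnected (proj Φ ⁻¹' F)ᶜ := hcount.isPathConnected_compl_of_one_lt_rank hrank
  have himage : proj Φ '' (proj Φ ⁻¹' F)ᶜ = Fᶜ := by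
    rw [← Set.preimage_compl, Set.image_preimage_eq _ hsurj]
  rw [← himage]
  exact hpc.image (continuous_proj Φ)

/-- The `N`-torsion subgroup `T[N]` (as a set) is finite for `N ≠ 0`.
[cite: MochizukiAbsTopIII2015, Corollary 2.7 (b) p.59] -/
theorem finite_nsmul_eq_zero {N : ℕ} (hN : N ≠ 0) : {t : ComplexTorus Φ | N • t = 0}.Finite :=
  finite_preimage_nsmul_singleton Φ hN 0

/-- **`𝕌_N = T ∖ T[N]` is path-connected** (as a subset of the torus).
[cite: MochizukiAbsTopIII2015, Corollary 2.7 (b) p.59] -/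
theorem isPathConnected_nsmulLocus {N : ℕ} (hN : N ≠ 0) :
    IsPathConnected (nsmulLocus Φ N : Set (ComplexTorus Φ)) := by
  have h : (nsmulLocus Φ N : Set (ComplexTorus Φ)) = {t : ComplexTorus Φ | N • t = 0}ᶜ := by
    ext t
    simp
  rw [h]
  exact isPathConnected_compl_of_finite Φ (finite_nsmul_eq_zero Φ hN)

/-- `𝕌_N` is a (pre)connected space. [cite: MochizukiAbsTopIII2015, Corollary 2.7 (b) p.59] -/
theorem preconnectedSpace_nsmulLocus {N : ℕ} (hN : N ≠ 0) : PreconnectedSpace ↥(nsmulLocus Φ N) :=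
  isPreconnected_iff_preconnectedSpace.1 (isPathConnected_nsmulLocus Φ hN).isConnected.isPreconnected

/-- `𝕌_N` is non-empty: the torus has a point `t₀ ≠ 0` (all coordinates `1/2`), and `[N]` is onto.
[cite: MochizukiAbsTopIII2015, Corollary 2.7 (b) p.59] -/
theorem nonempty_nsmulLocus {N : ℕ} (hN : N ≠ 0) : Nonempty ↥(nsmulLocus Φ N) := by
  classical
  obtain ⟨i₀⟩ := nonempty_index Φ
  have hhalf : (((2⁻¹ : ℝ)) : AddCircle (1 : ℝ)) ≠ 0 := by
    have h := coe_sub_half_ne (2⁻¹ : ℝ)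
    rw [sub_self] at h
    exact fun h0 => h (by rw [h0]; rfl)
  have ht₀ : (fun _ : ι => ((2⁻¹ : ℝ) : AddCircle (1 : ℝ)) : ComplexTorus Φ) ≠ 0 :=
    fun h => hhalf (congr_fun h i₀)
  have hiso : IsIsogeny Φ Φ ((N : ℤ) • (1 : Matrix ι ι ℤ)) :=
    isIsogeny_smul_one Φ (by exact_mod_cast hN)
  obtain ⟨x, hx⟩ := hiso.surjective (fun _ : ι => ((2⁻¹ : ℝ) : AddCircle (1 : ℝ)))
  refine ⟨⟨x, ?_⟩⟩
  rw [mem_nsmulLocus_iff, ← mapMatrix_natCast_smul_one Φ N x, hx]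
  exact ht₀

/-! ### (2) Translations by `N`-torsion points are deck transformations -/

/-- `𝕌_N` is stable under translation by an `N`-torsion point.
[cite: MochizukiAbsTopIII2015, Corollary 2.7 (b) p.59] -/
theorem add_mem_nsmulLocus {N : ℕ} {k : ComplexTorus Φ} (hk : N • k = 0) {u : ComplexTorus Φ}
    (hu : u ∈ nsmulLocus Φ N) : u + k ∈ nsmulLocus Φ N := by
  rw [mem_nsmulLocus_iff] at hu ⊢
  rwa [smul_add, hk, add_zero]

/-- … and under translation by its negative. [cite: MochizukiAbsTopIII2015, Corollary 2.7 (b) p.59] -/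
theorem sub_mem_nsmulLocus {N : ℕ} {k : ComplexTorus Φ} (hk : N • k = 0) {u : ComplexTorus Φ}
    (hu : u ∈ nsmulLocus Φ N) : u - k ∈ nsmulLocus Φ N := by
  rw [mem_nsmulLocus_iff] at hu ⊢
  rwa [smul_sub, hk, sub_zero]

/-- **Translations by `N`-torsion points restrict to deck transformations of `[N] : 𝕌_N → 𝔼`**: for
`k ∈ T[N]` there is a deck transformation acting as `u ↦ u + k` (the restriction of the translation
`Homeomorph.addRight k` to the invariant open `𝕌_N`). [cite: MochizukiAbsTopIII2015, Corollary 2.7 (b) p.59] -/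
theorem exists_deck_translate (N : ℕ) (k : ComplexTorus Φ) (hk : N • k = 0) :
    ∃ φ : deckGroup (nsmulCov Φ N), ∀ u : ↥(nsmulLocus Φ N),
      (((φ : ↥(nsmulLocus Φ N) ≃ₜ ↥(nsmulLocus Φ N)) u : ↥(nsmulLocus Φ N)) : ComplexTorus Φ) = u + k := by
  let ψ : ↥(nsmulLocus Φ N) ≃ₜ ↥(nsmulLocus Φ N) :=
    { toFun := fun u => ⟨(u : ComplexTorus Φ) + k, add_mem_nsmulLocus Φ hk u.2⟩
      invFun := fun u => ⟨(u : ComplexTorus Φ) - k, sub_mem_nsmulLocus Φ hk u.2⟩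
      left_inv := fun _ => Subtype.ext (add_sub_cancel_right _ _)
      right_inv := fun _ => Subtype.ext (sub_add_cancel _ _)
      continuous_toFun := (continuous_subtype_val.add continuous_const).subtype_mk _
      continuous_invFun := (continuous_subtype_val.sub continuous_const).subtype_mk _ }
  have hψ : ψ ∈ deckGroup (nsmulCov Φ N) := by
    intro u
    apply Subtype.ext
    change N • ((u : ComplexTorus Φ) + k) = N • (u : ComplexTorus Φ)
    rw [smul_add, hk, add_zero]
  exact ⟨⟨ψ, hψ⟩, fun _ => rfl⟩

/-! ### (3) Every deck transformation is such a translation -/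

/-- The displacement `φ(u) − u` of a deck transformation is an `N`-torsion point.
[cite: MochizukiAbsTopIII2015, Corollary 2.7 (b) p.59] -/
theorem nsmul_sub_eq_zero_of_mem_deckGroup {N : ℕ} {φ : ↥(nsmulLocus Φ N) ≃ₜ ↥(nsmulLocus Φ N)}
    (hφ : φ ∈ deckGroup (nsmulCov Φ N)) (u : ↥(nsmulLocus Φ N)) :
    N • (((φ u : ↥(nsmulLocus Φ N)) : ComplexTorus Φ) - (u : ComplexTorus Φ)) = 0 := by
  have h := congrArg (fun y : ↥(puncturedTorus Φ) => (y : ComplexTorus Φ)) (hφ u)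
  simp only [coe_nsmulCov] at h
  rw [smul_sub, h, sub_self]

/-- The displacement as an element of the kernel `T[N]` of `nsmulAddMonoidHom N`.
[cite: MochizukiAbsTopIII2015, Corollary 2.7 (b) p.59] -/
theorem sub_mem_ker_of_mem_deckGroup {N : ℕ} {φ : ↥(nsmulLocus Φ N) ≃ₜ ↥(nsmulLocus Φ N)}
    (hφ : φ ∈ deckGroup (nsmulCov Φ N)) (u : ↥(nsmulLocus Φ N)) :
    ((φ u : ↥(nsmulLocus Φ N)) : ComplexTorus Φ) - (u : ComplexTorus Φ) ∈
      (nsmulAddMonoidHom N : ComplexTorus Φ →+ ComplexTorus Φ).ker := by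
  rw [AddMonoidHom.mem_ker, nsmulAddMonoidHom_apply]
  exact nsmul_sub_eq_zero_of_mem_deckGroup Φ hφ u

omit [Fintype ι] in
/-- Elements of the kernel of `nsmulAddMonoidHom N` are `N`-torsion points.
[cite: MochizukiAbsTopIII2015, Corollary 2.7 (b) p.59] -/
theorem nsmul_coe_eq_zero_of_mem_ker {N : ℕ}
    (k : (nsmulAddMonoidHom N : ComplexTorus Φ →+ ComplexTorus Φ).ker) : N • (k : ComplexTorus Φ) = 0 := by
  have hk := k.2
  rwa [AddMonoidHom.mem_ker, nsmulAddMonoidHom_apply] at hk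

/-- **Every deck transformation of `[N] : 𝕌_N → 𝔼` is the restriction of the translation by the
`N`-torsion point `φ(u₀) − u₀`** (`𝕌_N` is connected and a deck transformation of a covering is
determined by one value, `ComplexTorus.deck_eq_of_apply_eq`).
[cite: MochizukiAbsTopIII2015, Corollary 2.7 (b) p.59] -/
theorem coe_apply_of_mem_deckGroup {N : ℕ} (hN : N ≠ 0)
    {φ : ↥(nsmulLocus Φ N) ≃ₜ ↥(nsmulLocus Φ N)} (hφ : φ ∈ deckGroup (nsmulCov Φ N))
    (u₀ u : ↥(nsmulLocus Φ N)) :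
    ((φ u : ↥(nsmulLocus Φ N)) : ComplexTorus Φ) =
      (u : ComplexTorus Φ) + ((((φ u₀ : ↥(nsmulLocus Φ N)) : ComplexTorus Φ) - (u₀ : ComplexTorus Φ))) := by
  haveI := preconnectedSpace_nsmulLocus Φ hN
  obtain ⟨ψ, hψ⟩ := exists_deck_translate Φ N _ (nsmul_sub_eq_zero_of_mem_deckGroup Φ hφ u₀)
  have hφψ : φ = (ψ : ↥(nsmulLocus Φ N) ≃ₜ ↥(nsmulLocus Φ N)) := by
    refine deck_eq_of_apply_eq (isFiniteEtale_nsmulCov Φ hN).isCoveringMap hφ ψ.2 (y := u₀) ?_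
    apply Subtype.ext
    rw [hψ u₀, add_sub_cancel]
  have h := hψ u
  rw [← hφψ] at h
  exact h

/-! ### (4) The statements -/

/-- **(b).3 at fixed `(Φ, N)`**: the deck group of `[N] : 𝕌_N → 𝔼` is commutative and transitive on
fibres. [cite: MochizukiAbsTopIII2015, Corollary 2.7 (b) p.59] -/
theorem nsmulDeck_abelian_transitive {N : ℕ} (hN : N ≠ 0) :
    (∀ φ ψ : deckGroup (nsmulCov Φ N), φ * ψ = ψ * φ) ∧
      ∀ u u' : nsmulLocus Φ N, nsmulCov Φ N u = nsmulCov Φ N u' →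
        ∃ φ : deckGroup (nsmulCov Φ N), (φ : nsmulLocus Φ N ≃ₜ nsmulLocus Φ N) u = u' := by
  obtain ⟨u₀⟩ := nonempty_nsmulLocus Φ hN
  refine ⟨fun φ ψ => ?_, fun u u' h => ?_⟩
  · have hφ := coe_apply_of_mem_deckGroup Φ hN φ.2 u₀
    have hψ := coe_apply_of_mem_deckGroup Φ hN ψ.2 u₀
    apply Subtype.ext
    refine Homeomorph.ext fun u => Subtype.ext ?_
    rw [Subgroup.coe_mul, Subgroup.coe_mul, Homeomorph.mul_apply, Homeomorph.mul_apply,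
      hφ ((ψ : ↥(nsmulLocus Φ N) ≃ₜ ↥(nsmulLocus Φ N)) u), hψ u,
      hψ ((φ : ↥(nsmulLocus Φ N) ≃ₜ ↥(nsmulLocus Φ N)) u), hφ u]
    abel
  · have hk : N • ((u' : ComplexTorus Φ) - (u : ComplexTorus Φ)) = 0 := by
      have h' := congrArg (fun y : ↥(puncturedTorus Φ) => (y : ComplexTorus Φ)) h
      simp only [coe_nsmulCov] at h'
      rw [smul_sub, h', sub_self]
    obtain ⟨φ, hφ⟩ := exists_deck_translate Φ N _ hk
    refine ⟨φ, Subtype.ext ?_⟩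
    rw [hφ u]
    abel

/-- **(b).3♯ at fixed `(Φ, N)`**: `Gal(𝕌_N/𝔼) ≅ T[N]`, `φ ↦ φ(u₀) − u₀`, and every deck transformation is
the restricted translation by its image. [cite: MochizukiAbsTopIII2015, Corollary 2.7 (b) p.59] -/
theorem exists_deckGroup_mulEquiv_ker {N : ℕ} (hN : N ≠ 0) :
    ∃ e : deckGroup (nsmulCov Φ N) ≃*
        Multiplicative ((nsmulAddMonoidHom N : ComplexTorus Φ →+ ComplexTorus Φ).ker),
      ∀ (φ : deckGroup (nsmulCov Φ N)) (u : nsmulLocus Φ N),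
        (((φ : nsmulLocus Φ N ≃ₜ nsmulLocus Φ N) u : nsmulLocus Φ N) : ComplexTorus Φ) =
          (u : ComplexTorus Φ) + ((Multiplicative.toAdd (e φ) : (nsmulAddMonoidHom N :
            ComplexTorus Φ →+ ComplexTorus Φ).ker) : ComplexTorus Φ) := by
  obtain ⟨u₀⟩ := nonempty_nsmulLocus Φ hN
  -- the displacement map `φ ↦ φ(u₀) − u₀ ∈ T[N]` and its inverse `k ↦ (· + k)`
  let d : deckGroup (nsmulCov Φ N) → (nsmulAddMonoidHom N : ComplexTorus Φ →+ ComplexTorus Φ).ker :=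
    fun φ => ⟨_, sub_mem_ker_of_mem_deckGroup Φ φ.2 u₀⟩
  have hd : ∀ (φ : deckGroup (nsmulCov Φ N)) (u : ↥(nsmulLocus Φ N)),
      (((φ : ↥(nsmulLocus Φ N) ≃ₜ ↥(nsmulLocus Φ N)) u : ↥(nsmulLocus Φ N)) : ComplexTorus Φ) =
        (u : ComplexTorus Φ) + (d φ : ComplexTorus Φ) :=
    fun φ u => coe_apply_of_mem_deckGroup Φ hN φ.2 u₀ u
  let i : (nsmulAddMonoidHom N : ComplexTorus Φ →+ ComplexTorus Φ).ker → deckGroup (nsmulCov Φ N) :=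
    fun k => (exists_deck_translate Φ N (k : ComplexTorus Φ) (nsmul_coe_eq_zero_of_mem_ker Φ k)).choose
  have hi : ∀ (k : (nsmulAddMonoidHom N : ComplexTorus Φ →+ ComplexTorus Φ).ker) (u : ↥(nsmulLocus Φ N)),
      ((((i k : deckGroup (nsmulCov Φ N)) : ↥(nsmulLocus Φ N) ≃ₜ ↥(nsmulLocus Φ N)) u :
        ↥(nsmulLocus Φ N)) : ComplexTorus Φ) = u + k :=
    fun k => (exists_deck_translate Φ N (k : ComplexTorus Φ) (nsmul_coe_eq_zero_of_mem_ker Φ k)).choose_spec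
  have hleft : ∀ φ, i (d φ) = φ := by
    intro φ
    apply Subtype.ext
    refine Homeomorph.ext fun u => Subtype.ext ?_
    rw [hi, hd φ u]
  have hright : ∀ k, d (i k) = k := by
    intro k
    apply Subtype.ext
    change ((((i k : deckGroup (nsmulCov Φ N)) : ↥(nsmulLocus Φ N) ≃ₜ ↥(nsmulLocus Φ N)) u₀ :
        ↥(nsmulLocus Φ N)) : ComplexTorus Φ) - (u₀ : ComplexTorus Φ) = (k : ComplexTorus Φ)
    rw [hi, add_sub_cancel_left]
  have hmul : ∀ φ ψ, d (φ * ψ) = d φ + d ψ := by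
    intro φ ψ
    apply Subtype.ext
    change ((((φ : ↥(nsmulLocus Φ N) ≃ₜ ↥(nsmulLocus Φ N)) * (ψ : ↥(nsmulLocus Φ N) ≃ₜ ↥(nsmulLocus Φ N)))
        u₀ : ↥(nsmulLocus Φ N)) : ComplexTorus Φ) - (u₀ : ComplexTorus Φ) =
      (d φ : ComplexTorus Φ) + (d ψ : ComplexTorus Φ)
    rw [Homeomorph.mul_apply, hd φ, hd ψ]
    abel
  refine ⟨{ toFun := fun φ => Multiplicative.ofAdd (d φ)
            invFun := fun k => i (Multiplicative.toAdd k)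
            left_inv := fun φ => by simpa only [toAdd_ofAdd] using hleft φ
            right_inv := fun k => by
              apply Multiplicative.toAdd.injective
              simpa only [toAdd_ofAdd] using hright (Multiplicative.toAdd k)
            map_mul' := fun φ ψ => by
              apply Multiplicative.toAdd.injective
              rw [toAdd_ofAdd, toAdd_mul, toAdd_ofAdd, toAdd_ofAdd, hmul] }, fun φ u => ?_⟩
  exact hd φ u

end

/-- **`NsmulDeckAbelianTransitive` HOLDS** (sub-DAG Cor-27, row b.r6 (b).3; FQ-typed closing theorem).
[cite: MochizukiAbsTopIII2015, Corollary 2.7 (b) p.59] -/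
theorem nsmulDeckAbelianTransitive_holds :
    Literature.AnabelianGeometry.AbsoluteAnabelian.HolomorphicEllipticCuspidalization.NsmulDeckAbelianTransitive :=
  fun _ι _ Φ _N hN => nsmulDeck_abelian_transitive Φ hN

/-- `NsmulDeckAbelianTransitive` — `_holds` alias of `nsmulDeckAbelianTransitive_holds` above under the fact's exact name (appended
2026-08-28, D-0026 bookkeeping: the proof term is the existing theorem of this file; no statement,
definition or attribute is edited; no new named fact; the ledger's debt table listed the fact
unproved). [cite: MochizukiAbsTopIII2015, Corollary 2.7 (b) p.59] -/
theorem _root_.Literature.AnabelianGeometry.AbsoluteAnabelian.HolomorphicEllipticCuspidalization.NsmulDeckAbelianTransitive_holds :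
    Literature.AnabelianGeometry.AbsoluteAnabelian.HolomorphicEllipticCuspidalization.NsmulDeckAbelianTransitive :=
  _root_.Literature.AnabelianGeometry.AbsoluteAnabelian.HolomorphicEllipticCuspidalization.nsmulDeckAbelianTransitive_holds

/-- **`NsmulDeckGroup` HOLDS** (sub-DAG Cor-27, row b.r6 (b).3♯; FQ-typed closing theorem).
[cite: MochizukiAbsTopIII2015, Corollary 2.7 (b) p.59] -/
theorem nsmulDeckGroup_holds :
    Literature.AnabelianGeometry.AbsoluteAnabelian.HolomorphicEllipticCuspidalization.NsmulDeckGroup :=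
  fun _ι _ Φ _N hN => exists_deckGroup_mulEquiv_ker Φ hN

/-- `NsmulDeckGroup` — `_holds` alias of `nsmulDeckGroup_holds` above under the fact's exact name (appended
2026-08-28, D-0026 bookkeeping: the proof term is the existing theorem of this file; no statement,
definition or attribute is edited; no new named fact; the ledger's debt table listed the fact
unproved). [cite: MochizukiAbsTopIII2015, Corollary 2.7 (b) p.59] -/
theorem _root_.Literature.AnabelianGeometry.AbsoluteAnabelian.HolomorphicEllipticCuspidalization.NsmulDeckGroup_holds :
    Literature.AnabelianGeometry.AbsoluteAnabelian.HolomorphicEllipticCuspidalization.NsmulDeckGroup :=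
  _root_.Literature.AnabelianGeometry.AbsoluteAnabelian.HolomorphicEllipticCuspidalization.nsmulDeckGroup_holds

end HolomorphicEllipticCuspidalization

end Literature.AnabelianGeometry.AbsoluteAnabelian

end
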